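import Summits.Ventures.PercRepro.ProfilePointedCircuitClassesStarSharpD0B

/-!
# PercRepro — CASE D0 OF `StarNineSharp`, PART D: THE ON PLANE `H` THROUGH `e` AND `f` IN THE «NO ON LINE» REGIME
(p5, gen 54; `proofs/P5-GM1.md` §81 (c), rules R1 / R4)

Let `H ⊆ E₇` be a flat of rank `3` through `e, f` that is ON (`ρ(H ∪ {b, b′}) = 4`), with no ON line.  Then every ON
rank-`3` subset of `E₇` through `e, f` lies in `H` (`subset_H_of_on_ef`: two ON planes through the line `ef` would
force it), `H` has at most `5` points (`card_H_le_five`: a `6`-point ON plane would make its complement a coloop of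
`N`), and for a demand `π + e + b` with `π ⊆ H`:
* R1: if `π + f ∈ A` then `π + f + b ∈ BI_4(N)` is ON (`r1_image`);
* R4: a point `w ∉ H` of `X` never gives an ON demand `(X − π − w) + e` (`not_on_demand_of_meets_H`), and the
  triple `{w} ∪ π` is OFF (`triple_off`) — the facts behind the triple targets of rule R4a; the C-point of rule R4b
  and the uniqueness of the R4b demand are in part D2.
-/

open scoped Matroid

namespace PercRepro.Cogirth

open Finset ThmH Skew Shadow Profile

variable {α : Type} [DecidableEq α] {N : Matroid α} [N.Finite]

section StarSharpD0D

variable {b b' : α}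

/-- If `f` adds no rank to `S` then it adds no rank to `S ∪ T` (copy of D0C's lemma). -/
theorem rk_insert_union_eq_of_rk_insert_eq' {S T : Finset α} {f : α} (hS : rk N (insert f S) = rk N S) :
    rk N (insert f (S ∪ T)) = rk N (S ∪ T) := by
  have h1 := rk_union_add_rk_le_of_subset_inter' (N := N) (S := insert f S) (T := S ∪ T) (I := S)
    (by intro x hx; exact mem_inter.2 ⟨mem_insert_of_mem hx, mem_union_left _ hx⟩)
  have e1 : insert f S ∪ (S ∪ T) = insert f (S ∪ T) := by ext x; simp only [mem_union, mem_insert]; tauto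
  rw [e1, hS] at h1
  have h2 : rk N (S ∪ T) ≤ rk N (insert f (S ∪ T)) := rk_mono' (M := N) (subset_insert _ _)
  omega

/-- A point adding rank to a flat `H` adds rank to every subset of `H` (submodularity). -/
theorem rk_insert_eq_add_one_of_subset_flat {H S : Finset α} {z : α} (hz : z ∈ gr N) (hHg : H ⊆ gr N)
    (hS : S ⊆ H) (hzH : rk N (insert z H) = rk N H + 1) : rk N (insert z S) = rk N S + 1 := by
  have h1 := rk_union_add_rk_le_of_subset_inter' (N := N) (S := insert z S) (T := H) (I := S)
    (by intro x hx; exact mem_inter.2 ⟨mem_insert_of_mem hx, hS hx⟩)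
  have e1 : insert z S ∪ H = insert z H := by
    ext x; simp only [mem_union, mem_insert]
    constructor
    · rintro ((rfl | hx) | hx)
      · exact Or.inl rfl
      · exact Or.inr (hS hx)
      · exact Or.inr hx
    · rintro (rfl | hx)
      · exact Or.inl (Or.inl rfl)
      · exact Or.inr hx
  rw [e1, hzH] at h1
  have h2 := rk_insert_le_add_one (N := N) hz (hS.trans hHg)
  omega

/-- **EVERY ON RANK-3 SET THROUGH `e, f` LIES IN `H`** (no ON line): an ON plane `S ⊄ H` through `e, f` would meet
the ON plane `H` in the line `ef`. -/
theorem subset_H_of_on_ef (h : SeriesPair N b b') (hR : rk N (gr N) = 5)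
    (hE7 : rk N (((gr N).erase b).erase b') = 4)
    (hnl : ∀ S : Finset α, S ⊆ ((gr N).erase b).erase b' → rk N (insert b (insert b' S)) ≤ 3 → rk N S ≤ 1)
    {e f : α} (hef2 : rk N {e, f} = 2) {H : Finset α} (hH : H ⊆ ((gr N).erase b).erase b') (heH : e ∈ H) (hfH : f ∈ H)
    (hH3 : rk N H = 3) (hHon : rk N (insert b (insert b' H)) = 4)
    (hHfl : ∀ z ∈ ((gr N).erase b).erase b', z ∉ H → rk N (insert z H) = 4)
    {S : Finset α} (hS : S ⊆ ((gr N).erase b).erase b') (heS : e ∈ S) (hfS : f ∈ S)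
    (hSon : rk N (insert b (insert b' S)) = 4) : S ⊆ H := by
  have hU3 : rk N (S ∪ H) = 3 := by
    have hle : rk N (S ∪ H) ≤ 4 := by
      have h1 : rk N (S ∪ H) ≤ rk N (((gr N).erase b).erase b') := rk_mono' (M := N) (union_subset hS hH)
      omega
    have hge : rk N H ≤ rk N (S ∪ H) := rk_mono' (M := N) subset_union_right
    by_contra hne
    have hU : rk N (S ∪ H) = 4 := by omega
    have hI := rk_inter_le_one_of_two_on h hR hnl hS hH hSon hHon hU
    have h2 : rk N {e, f} ≤ rk N (S ∩ H) := rk_mono' (M := N) (by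
      intro x hx; simp only [mem_insert, mem_singleton] at hx
      rcases hx with rfl | rfl
      · exact mem_inter.2 ⟨heS, heH⟩
      · exact mem_inter.2 ⟨hfS, hfH⟩)
    omega
  intro z hz
  by_contra hzH
  have h4 := hHfl z (hS hz) hzH
  have h5 : rk N (insert z H) ≤ rk N (S ∪ H) :=
    rk_mono' (M := N) (insert_subset (mem_union_left _ hz) subset_union_right)
  omega

/-- **AN ON PLANE HAS AT MOST FIVE POINTS**: `H = E₇` has rank `4`, and `H = E₇ − w` would give
`ρ(E − w) = ρ(H ∪ {b, b′}) = 4`, making `w` a coloop of `N`. -/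
theorem card_H_le_five (h : SeriesPair N b b') (hn : (gr N).card = 9)
    (hcf : ∀ x ∈ gr N, rk N ((gr N).erase x) = 5) (hE7 : rk N (((gr N).erase b).erase b') = 4)
    {H : Finset α} (hH : H ⊆ ((gr N).erase b).erase b') (hH3 : rk N H = 3)
    (hHon : rk N (insert b (insert b' H)) = 4) : H.card ≤ 5 := by
  have hb : b ∈ gr N := h.1; have hb' : b' ∈ gr N := h.2.1; have hbb' : b ≠ b' := h.2.2.1
  have hE7c : (((gr N).erase b).erase b').card = 7 := by
    rw [card_erase_of_mem (mem_erase.2 ⟨hbb'.symm, hb'⟩), card_erase_of_mem hb, hn]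
  by_contra hlt
  push Not at hlt
  have hcs : (((gr N).erase b).erase b' \ H).card ≤ 1 := by
    rw [card_sdiff_of_subset hH, hE7c]; omega
  rcases Nat.le_one_iff_eq_zero_or_eq_one.1 hcs with h0 | h1
  · rw [card_eq_zero, sdiff_eq_empty_iff_subset] at h0
    have : H = ((gr N).erase b).erase b' := subset_antisymm hH h0
    rw [this, hE7] at hH3
    exact absurd hH3 (by norm_num)
  · obtain ⟨w, hw⟩ := card_eq_one.1 h1
    have hwmem : w ∈ ((gr N).erase b).erase b' \ H := hw ▸ mem_singleton_self w
    have hwE : w ∈ ((gr N).erase b).erase b' := (mem_sdiff.1 hwmem).1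
    have hwg : w ∈ gr N := (mem_erase.1 (mem_erase.1 hwE).2).2
    have hwb : w ≠ b := (mem_erase.1 (mem_erase.1 hwE).2).1
    have hwb' : w ≠ b' := (mem_erase.1 hwE).1
    have hHeq : H = (((gr N).erase b).erase b').erase w := by
      ext x
      constructor
      · intro hx
        exact mem_erase.2 ⟨fun hxw => (mem_sdiff.1 hwmem).2 (hxw ▸ hx), hH hx⟩
      · intro hx
        by_contra hxH
        have : x ∈ ((gr N).erase b).erase b' \ H := mem_sdiff.2 ⟨mem_of_mem_erase hx, hxH⟩
        rw [hw, mem_singleton] at this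
        exact (mem_erase.1 hx).1 this
    have hcomp : (gr N).erase w = insert b (insert b' ((((gr N).erase b).erase b').erase w)) := by
      ext x
      simp only [mem_erase, mem_insert]
      constructor
      · rintro ⟨hxw, hxg⟩
        by_cases hxb : x = b
        · exact Or.inl hxb
        by_cases hxb' : x = b'
        · exact Or.inr (Or.inl hxb')
        exact Or.inr (Or.inr ⟨hxw, hxb', hxb, hxg⟩)
      · rintro (rfl | rfl | ⟨hxw, -, -, hxg⟩)
        · exact ⟨hwb.symm, hb⟩
        · exact ⟨hwb'.symm, hb'⟩
        · exact ⟨hxw, hxg⟩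
    have h5 := hcf w hwg
    rw [hcomp, ← hHeq, hHon] at h5
    exact absurd h5 (by norm_num)

/-- **NO ON DEMAND THROUGH A POINT OF `H` AND A POINT OFF `H`**: for `t ∈ H` and `w ∉ H` (both in `X`), the set
`{w, t} + e` cannot be an ON demand — it would be an ON plane meeting `H` in the line `{e, t}`. -/
theorem not_on_demand_of_meets_H (h : SeriesPair N b b') (hn : (gr N).card = 9) (hR : rk N (gr N) = 5)
    (hE7 : rk N (((gr N).erase b).erase b') = 4)
    (hnl : ∀ S : Finset α, S ⊆ ((gr N).erase b).erase b' → rk N (insert b (insert b' S)) ≤ 3 → rk N S ≤ 1)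
    {e f : α} (he : e ∈ gr N) (heb : e ≠ b) (heb' : e ≠ b')
    (he1 : ∀ y ∈ ((((gr N).erase b).erase b').erase f).erase e, rk N {e, y} = 2)
    {H : Finset α} (hH : H ⊆ ((gr N).erase b).erase b') (heH : e ∈ H)
    (hHon : rk N (insert b (insert b' H)) = 4)
    (hHfl : ∀ z ∈ ((gr N).erase b).erase b', z ∉ H → rk N (insert z H) = 4)
    {t w : α} (ht : t ∈ ((((gr N).erase b).erase b').erase f).erase e) (htH : t ∈ H)
    (hw : w ∈ ((((gr N).erase b).erase b').erase f).erase e) (hwH : w ∉ H) :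
    ¬ (insert b (insert e {w, t}) ∈ biIndepSets N 4 ∧ rk N (insert b (insert b' (insert e {w, t}))) = 4) := by
  rintro ⟨-, hon⟩
  have _ := hn
  have hXE : ((((gr N).erase b).erase b').erase f).erase e ⊆ ((gr N).erase b).erase b' :=
    (erase_subset _ _).trans (erase_subset _ _)
  have heE : e ∈ ((gr N).erase b).erase b' := mem_erase.2 ⟨heb', mem_erase.2 ⟨heb, he⟩⟩
  have hSE : insert e {w, t} ⊆ ((gr N).erase b).erase b' :=
    insert_subset heE (by
      intro x hx; simp only [mem_insert, mem_singleton] at hx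
      rcases hx with rfl | rfl
      · exact hXE hw
      · exact hXE ht)
  have hU : rk N (insert e {w, t} ∪ H) = 4 := by
    have h1 : rk N (insert w H) ≤ rk N (insert e {w, t} ∪ H) := rk_mono' (M := N) (by
      intro x hx; simp only [mem_insert, mem_union, mem_singleton] at hx ⊢; tauto)
    have h2 : rk N (insert e {w, t} ∪ H) ≤ rk N (((gr N).erase b).erase b') := rk_mono' (M := N) (union_subset hSE hH)
    have h3 := hHfl w (hXE hw) hwH
    omega
  have hI := rk_inter_le_one_of_two_on h hR hnl hSE hH hon hHon hU
  have h2 : rk N {e, t} ≤ rk N (insert e {w, t} ∩ H) := rk_mono' (M := N) (by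
    intro x hx; simp only [mem_insert, mem_singleton] at hx
    rcases hx with rfl | rfl
    · exact mem_inter.2 ⟨mem_insert_self _ _, heH⟩
    · exact mem_inter.2 ⟨mem_insert_of_mem (mem_insert_of_mem (mem_singleton_self _)), htH⟩)
  have := he1 t ht
  omega

/-- **THE TRIPLE `{w} ∪ π` IS OFF** for `π ⊆ H` with `ρ(π + e) = 3` ON and `w ∈ X ∖ H`: an ON `{w} ∪ π` would meet
the ON set `π + e` in the line `π`. -/
theorem triple_off (h : SeriesPair N b b') (hR : rk N (gr N) = 5)
    (hnl : ∀ S : Finset α, S ⊆ ((gr N).erase b).erase b' → rk N (insert b (insert b' S)) ≤ 3 → rk N S ≤ 1)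
    {e f : α} {H : Finset α} (hH : H ⊆ ((gr N).erase b).erase b') (hH3 : rk N H = 3)
    (hHfl : ∀ z ∈ ((gr N).erase b).erase b', z ∉ H → rk N (insert z H) = 4)
    {π : Finset α} (hπ : π ⊆ ((((gr N).erase b).erase b').erase f).erase e) (hπ2 : π.card = 2)
    (hπH : insert e π ⊆ H) (hY : rk N (insert e π) = 3) (hYon : rk N (insert b (insert b' (insert e π))) = 4)
    {w : α} (hw : w ∈ ((((gr N).erase b).erase b').erase f).erase e) (hwH : w ∉ H) :
    rk N (insert w π) = 3 ∧ rk N (insert b (insert b' (insert w π))) = 5 := by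
  have hXE : ((((gr N).erase b).erase b').erase f).erase e ⊆ ((gr N).erase b).erase b' :=
    (erase_subset _ _).trans (erase_subset _ _)
  have hHg : H ⊆ gr N := hH.trans ((erase_subset _ _).trans (erase_subset _ _))
  have hwg : w ∈ gr N := (mem_erase.1 (mem_erase.1 (hXE hw)).2).2
  have hπr : rk N π = 2 := by
    rw [rk_eq_card_of_subset_of_rk_eq_card (M := N) (subset_insert e π) (by
      rw [hY, card_insert_of_notMem (fun h' => (mem_erase.1 (hπ h')).1 rfl), hπ2]), hπ2]
  have hzH : rk N (insert w H) = rk N H + 1 := by rw [hHfl w (hXE hw) hwH, hH3]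
  have hwπ : rk N (insert w π) = 3 := by
    rw [rk_insert_eq_add_one_of_subset_flat hwg hHg ((subset_insert e π).trans hπH) hzH, hπr]
  refine ⟨hwπ, ?_⟩
  have hwπE : insert w π ⊆ ((gr N).erase b).erase b' := insert_subset (hXE hw) (hπ.trans hXE)
  apply rk_insert_bb'_eq_five_of_not_on h hwπE hwπ
  intro hon
  have hU : rk N (insert w π ∪ insert e π) = 4 := by
    have e1 : insert w π ∪ insert e π = insert w (insert e π) := by
      ext x; simp only [mem_union, mem_insert]; tauto
    rw [e1, rk_insert_eq_add_one_of_subset_flat hwg hHg hπH hzH, hY]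
  have hI := rk_inter_le_one_of_two_on h hR hnl hwπE (hπH.trans hH) hon hYon hU
  have h2 : rk N π ≤ rk N (insert w π ∩ insert e π) := rk_mono' (M := N) (by
    intro x hx; exact mem_inter.2 ⟨mem_insert_of_mem hx, mem_insert_of_mem hx⟩)
  omega

/-- The complement of `π + f` in `E₇` is `(X ∖ π) + e`. -/
theorem E7_sdiff_insert_f_eq {e f : α} (he : e ∈ gr N) (hef : e ≠ f) (heb : e ≠ b) (heb' : e ≠ b') {π : Finset α}
    (hπ : π ⊆ ((((gr N).erase b).erase b').erase f).erase e) :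
    ((gr N).erase b).erase b' \ insert f π = insert e (((((gr N).erase b).erase b').erase f).erase e \ π) := by
  ext x
  simp only [mem_sdiff, mem_insert, mem_erase, not_or]
  constructor
  · rintro ⟨⟨hxb', hxb, hxg⟩, hxf, hxπ⟩
    by_cases hxe : x = e
    · exact Or.inl hxe
    · exact Or.inr ⟨⟨hxe, hxf, hxb', hxb, hxg⟩, hxπ⟩
  · rintro (rfl | ⟨⟨hxe, hxf, hxb', hxb, hxg⟩, hxπ⟩)
    · exact ⟨⟨heb', heb, he⟩, hef, fun h' => (mem_erase.1 (hπ h')).1 rfl⟩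
    · exact ⟨⟨hxb', hxb, hxg⟩, hxf, hxπ⟩

/-- R1: for `π` with `π + e` an ON demand, `f ∈ cl(π + e)` and `π + f ∈ A`, the set `π + f + b` is bi-independent
and ON. -/
theorem r1_image (h : SeriesPair N b b') (hn : (gr N).card = 9) {e f : α} (he : e ∈ gr N) (hf : f ∈ gr N) (hef : e ≠ f)
    (heb : e ≠ b) (heb' : e ≠ b') (hfb : f ≠ b) (hfb' : f ≠ b')
    {π : Finset α} (hπ : π ⊆ ((((gr N).erase b).erase b').erase f).erase e) (hπ2 : π.card = 2)
    (hY : rk N (insert e π) = 3) (hYon : rk N (insert b (insert b' (insert e π))) = 4)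
    (hef3 : rk N (insert f (insert e π)) = 3) (hπf : rk N (insert f π) = 3)
    (hcompl : rk N (insert e (((((gr N).erase b).erase b').erase f).erase e \ π)) = 4) :
    insert b (insert f π) ∈ biIndepSets N 4 ∧ rk N (insert b (insert b' (insert f π))) = 4 := by
  have hXE : ((((gr N).erase b).erase b').erase f).erase e ⊆ ((gr N).erase b).erase b' :=
    (erase_subset _ _).trans (erase_subset _ _)
  have hfE : f ∈ ((gr N).erase b).erase b' := mem_erase.2 ⟨hfb', mem_erase.2 ⟨hfb, hf⟩⟩
  have hfπ : f ∉ π := fun h' => (mem_erase.1 (mem_erase.1 (hπ h')).2).1 rfl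
  have hfπE : insert f π ⊆ ((gr N).erase b).erase b' := insert_subset hfE (hπ.trans hXE)
  have hfπ3 : (insert f π).card = 3 := by rw [card_insert_of_notMem hfπ, hπ2]
  refine ⟨?_, ?_⟩
  · rw [insert_b_mem_biIndepSets_iff h hn hfπE hfπ3, E7_sdiff_insert_f_eq he hef heb heb' hπ]
    exact ⟨hπf, hcompl⟩
  · have hup : rk N (insert b (insert b' (insert f π))) ≤ 4 := by
      have e1 : insert b (insert b' (insert f (insert e π))) = insert f (insert e π ∪ {b, b'}) := by
        ext x; simp only [mem_insert, mem_union, mem_singleton]; tauto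
      have e2 : insert b (insert b' (insert e π)) = insert e π ∪ {b, b'} := by
        ext x; simp only [mem_insert, mem_union, mem_singleton]; tauto
      have h1 : rk N (insert f (insert e π ∪ {b, b'})) = rk N (insert e π ∪ {b, b'}) :=
        rk_insert_union_eq_of_rk_insert_eq' (by rw [hef3, hY])
      have h2 : rk N (insert b (insert b' (insert f π))) ≤ rk N (insert b (insert b' (insert f (insert e π)))) :=
        rk_mono' (M := N) (insert_subset_insert b (insert_subset_insert b' (insert_subset_insert f (subset_insert e π))))
      rw [e1, h1, ← e2, hYon] at h2
      exact h2
    have := rk_insert_bb'_bounds h hfπE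
    omega

end StarSharpD0D

end PercRepro.Cogirth
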